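import Literature.MathematicalPhysics.QuantumLattice.FinDimSpectrumSectorGibbsLimit
import Literature.MathematicalPhysics.QuantumLattice.HubbardRingPerronFrobeniusProofs
import Literature.MathematicalPhysics.QuantumLattice.PairCorrelations
import HarnessLib

/-!
# Route BalabanIR — crux 4 `BirGappedPhaseReduction` (item `stmt-HubbardSuperconductivity-2082`): the THESES-FREE zero-temperature endgame (structural form)

The route file's materialisation rule (rev 5, 2026-08-16) forbids a CLOSING module from importing
`Summits/…/Theses/BalabanIR` (directly or transitively): closing theorems must state the item's body
STRUCTURALLY. The zero-temperature endgame of the reduction — "a thermal (canonical, sector) bound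
on `Δ_d† Δ_d`, uniform or frequent in `β`, gives the ground-state-AVERAGE bound of the target" —
was landed in `Theorems/BalabanIRBirGappedPhaseReduction{SectorGibbs,Thermal,ThermalSeq}.lean`,
which name the route's declarations and therefore import the Theses file. This module re-proves
that endgame WITHOUT any Theses import, with conclusions written as the BODY of the target
`BirGroundStateAverageLRO` verbatim, so that a closing module may import it:

* `groundEigenspace_hubbardTorus_ne_bot`, `szSector_invariant_hubbardTorus` — the sector
  `(2m, 0)` of `hubbardTorus d L t U` is invariant and has a non-trivial ground eigenspace;
* `sectorTraceBound_of_eventually_thermal` / `sectorTraceBound_of_frequently_thermal` — at fixed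
  `L`, an eventual (frequent) lower bound `c L⁴` on the canonical sector Gibbs average of `Δ_d† Δ_d`
  gives `c L⁴ re tr P ≤ re tr (P Δ_d† Δ_d)` for the sector ground projection `P`
  (`mul_re_trace_le_of_{eventually,frequently}_sectorGibbsAverage` of the Literature file
  `FinDimSpectrumSectorGibbsLimit`);
* `dWaveGroundStateAverageLRO_of_frequently_thermal`, `…_of_eventually_thermal`,
  `…_of_thermal_dyadic` — the thermal forms of the target imply ITS BODY (check in a scratch file
  importing the Theses module: `example : BalabanIR.BirGroundStateAverageLRO :=
  dWaveGroundStateAverageLRO_of_frequently_thermal h` elaborates);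
* `frequently_atTop_of_eventually_two_pow` — dyadic `β_k = a 2^{k+1}` are unbounded.

Sources: H. Tasaki, *Physics and Mathematics of Quantum Many-Body Systems* (2020), App. A, §2.2
(ground states as `β ↑ ∞` limits); E. H. Lieb, PRL 62 (1989) 1201 (sectors). Folklore; no
definition is introduced.
-/

noncomputable section

open scoped Matrix.Norms.L2Operator ComplexOrder MatrixOrder InnerProductSpace

namespace Summit.HubbardSuperconductivity.HubbardSuperconductivity.Theorems

open Matrix Filter Topology Literature.MathematicalPhysics.QuantumLattice
open Literature.Probability.LatticeModels

/-! ### The sector `(2m, 0)` of the Hubbard torus -/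

/-- **The sector ground eigenspace of the Hubbard torus is non-trivial.** For `m ≤ |Λ| = L^d` the
joint sector `(N, S^z) = (2m, 0)` contains a ground state (`szSector_groundState`), so
`szSector (2m) 0 ⊓ ker (H - e₀) ≠ ⊥`, `e₀ = H.minEnergyOn (szSector (2m) 0)`. Tasaki (2020) §2.2;
Lieb, PRL 62 (1989) 1201. [folklore] -/
theorem groundEigenspace_hubbardTorus_ne_bot (d L : ℕ) (t U : ℝ) {m : ℕ}
    (hm : m ≤ Fintype.card (FermionTorus d L)) :
    szSector (Λ := FermionTorus d L) (2 * m) 0 ⊓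
        Module.End.eigenspace (Matrix.toLin' (hubbardTorus d L t U))
          (((hubbardTorus d L t U).minEnergyOn
            (szSector (Λ := FermionTorus d L) (2 * m) 0) : ℝ) : ℂ) ≠ ⊥ := by
  obtain ⟨⟨ψ, hψS, hψ0, hHψ⟩, -⟩ := szSector_groundState (fermionTorusGraph d L) t U hm
  rw [Submodule.ne_bot_iff]
  refine ⟨ψ, Submodule.mem_inf.mpr ⟨hψS, ?_⟩, hψ0⟩
  rw [Module.End.mem_eigenspace_iff, Matrix.toLin'_apply]
  exact hHψ

/-- The joint sector `(2m, 0)` is invariant under the Hubbard torus (`H` conserves `(N↑, N↓)`,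
`LiebThm1.preservesSectors_hamiltonian`). Lieb, PRL 62 (1989) 1201. [folklore] -/
theorem szSector_invariant_hubbardTorus (d L : ℕ) (t U : ℝ) (m : ℕ)
    {ψ : Fock (Orb (FermionTorus d L))} (hψ : ψ ∈ szSector (Λ := FermionTorus d L) (2 * m) 0) :
    hubbardTorus d L t U *ᵥ ψ ∈ szSector (Λ := FermionTorus d L) (2 * m) 0 := by
  rw [mem_szSector_two_mul_zero_iff] at hψ ⊢
  exact (LiebThm1.preservesSectors_hamiltonian (fermionTorusGraph d L) t U).isInSector_mulVec hψ

/-- `⌊(1-δ)L²/2⌋ ≤ L² = |Λ|` for `δ ≥ -1` (the sector of the target is non-empty). [folklore] -/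
theorem natFloor_density_le_card (L : ℕ) (δ : ℝ) (hδ : -1 ≤ δ) :
    ⌊(1 - δ) * (L : ℝ) ^ 2 / 2⌋₊ ≤ Fintype.card (FermionTorus 2 L) := by
  have hcard : Fintype.card (FermionTorus 2 L) = L ^ 2 := by simp
  rw [hcard]
  apply Nat.floor_le_of_le
  have hL : (0 : ℝ) ≤ (L : ℝ) ^ 2 := by positivity
  push_cast
  nlinarith

/-! ### Thermal sector bounds pass to the ground-eigenspace average -/

/-- **Zero-temperature step, eventual form (structural).** For any side `L`, hopping `t`, coupling
`U`, `δ ≥ -1` and constant `c`: if the canonical `(2⌊(1-δ)L²/2⌋, S^z = 0)`-sector Gibbs average of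
`Δ_d† Δ_d` is `≥ c L⁴` for all large `β`, then `c · L⁴ · re tr P ≤ re tr (P Δ_d† Δ_d)` for the
projection `P` onto the sector ground eigenspace (`mul_re_trace_le_of_eventually_sectorGibbsAverage`).
Tasaki (2020) App. A. [folklore] -/
theorem sectorTraceBound_of_eventually_thermal (L : ℕ) [NeZero L] (t U δ c : ℝ) (hδ : -1 ≤ δ) :
    let N : ℕ := 2 * ⌊(1 - δ) * (L : ℝ) ^ 2 / 2⌋₊
    let H := hubbardTorus 2 L t U
    let S := szSector (Λ := FermionTorus 2 L) N 0
    let E₀ := S ⊓ Module.End.eigenspace (Matrix.toLin' H) ((H.minEnergyOn S : ℝ) : ℂ)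
    let P := projMatrix (E₀.map (Fock.toEuclidean (ι := Orb (FermionTorus 2 L)) :
      Fock (Orb (FermionTorus 2 L)) →ₗ[ℂ] EuclideanSpace ℂ (Finset (Orb (FermionTorus 2 L)))))
    let PS := projMatrix (S.map (Fock.toEuclidean (ι := Orb (FermionTorus 2 L)) :
      Fock (Orb (FermionTorus 2 L)) →ₗ[ℂ] EuclideanSpace ℂ (Finset (Orb (FermionTorus 2 L)))))
    let A := (pairField dWaveFormFactor L)ᴴ * pairField dWaveFormFactor L
    (∀ᶠ β : ℝ in atTop, c * (L : ℝ) ^ 4 ≤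
        ((PS * gibbsWeight β H * A).trace / (PS * gibbsWeight β H).trace).re) →
      c * (L : ℝ) ^ 4 * P.trace.re ≤ (P * A).trace.re := by
  intro N H S E₀ P PS A hth
  have hH : H.IsHermitian := LiebThm1.hamiltonian_isHermitian (fermionTorusGraph 2 L) t U
  have hinv : ∀ v ∈ S, H *ᵥ v ∈ S := fun v hv => szSector_invariant_hubbardTorus 2 L t U _ hv
  have hE₀ : E₀ ≠ ⊥ :=
    groundEigenspace_hubbardTorus_ne_bot 2 L t U (natFloor_density_le_card L δ hδ)
  exact mul_re_trace_le_of_eventually_sectorGibbsAverage hH S hinv hE₀ A (c * (L : ℝ) ^ 4) hth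

/-- **Zero-temperature step, frequent form (structural).** As
`sectorTraceBound_of_eventually_thermal`, with the sector Gibbs bound `≥ c L⁴` only on an
unbounded set of inverse temperatures (`∃ᶠ β in atTop`). Tasaki (2020) App. A. [folklore] -/
theorem sectorTraceBound_of_frequently_thermal (L : ℕ) [NeZero L] (t U δ c : ℝ) (hδ : -1 ≤ δ) :
    let N : ℕ := 2 * ⌊(1 - δ) * (L : ℝ) ^ 2 / 2⌋₊
    let H := hubbardTorus 2 L t U
    let S := szSector (Λ := FermionTorus 2 L) N 0
    let E₀ := S ⊓ Module.End.eigenspace (Matrix.toLin' H) ((H.minEnergyOn S : ℝ) : ℂ)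
    let P := projMatrix (E₀.map (Fock.toEuclidean (ι := Orb (FermionTorus 2 L)) :
      Fock (Orb (FermionTorus 2 L)) →ₗ[ℂ] EuclideanSpace ℂ (Finset (Orb (FermionTorus 2 L)))))
    let PS := projMatrix (S.map (Fock.toEuclidean (ι := Orb (FermionTorus 2 L)) :
      Fock (Orb (FermionTorus 2 L)) →ₗ[ℂ] EuclideanSpace ℂ (Finset (Orb (FermionTorus 2 L)))))
    let A := (pairField dWaveFormFactor L)ᴴ * pairField dWaveFormFactor L
    (∃ᶠ β : ℝ in atTop, c * (L : ℝ) ^ 4 ≤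
        ((PS * gibbsWeight β H * A).trace / (PS * gibbsWeight β H).trace).re) →
      c * (L : ℝ) ^ 4 * P.trace.re ≤ (P * A).trace.re := by
  intro N H S E₀ P PS A hth
  have hH : H.IsHermitian := LiebThm1.hamiltonian_isHermitian (fermionTorusGraph 2 L) t U
  have hinv : ∀ v ∈ S, H *ᵥ v ∈ S := fun v hv => szSector_invariant_hubbardTorus 2 L t U _ hv
  have hE₀ : E₀ ≠ ⊥ :=
    groundEigenspace_hubbardTorus_ne_bot 2 L t U (natFloor_density_le_card L δ hδ)
  exact mul_re_trace_le_of_frequently_sectorGibbsAverage hH S hinv hE₀ A (c * (L : ℝ) ^ 4) hth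

/-! ### Thermal forms of the target imply its body -/

/-- **Frequent thermal form ⇒ the target's body (structural, Theses-free).** If, for some
`δ ∈ (0,1/2)`, an open window `(U₁,U₂) ⊂ (0,∞)` and `c > 0`, for every `U` in the window,
eventually in even `L`, the canonical `(2⌊(1-δ)L²/2⌋, S^z = 0)`-sector Gibbs average of `Δ_d† Δ_d`
for `hubbardTorus 2 L 1 U` is `≥ c L⁴` on an unbounded set of inverse temperatures `β`, then the
BODY of the route's target `BirGroundStateAverageLRO` holds (ground-state-AVERAGE `d_{x²-y²}`
pair-field long-range order on the window). Tasaki (2020) App. A. [folklore] -/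
theorem dWaveGroundStateAverageLRO_of_frequently_thermal
    (h : ∃ δ ∈ Set.Ioo (0:ℝ) (1/2), ∃ U₁ U₂ c : ℝ, 0 < U₁ ∧ U₁ < U₂ ∧ 0 < c ∧
      ∀ U ∈ Set.Ioo U₁ U₂, ∃ L₀ : ℕ, ∀ (L : ℕ) [NeZero L], L₀ ≤ L → Even L →
        let N : ℕ := 2 * ⌊(1 - δ) * (L : ℝ) ^ 2 / 2⌋₊
        let H := hubbardTorus 2 L 1 U
        let S := szSector (Λ := FermionTorus 2 L) N 0
        let PS := projMatrix (S.map (Fock.toEuclidean (ι := Orb (FermionTorus 2 L)) :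
          Fock (Orb (FermionTorus 2 L)) →ₗ[ℂ] EuclideanSpace ℂ (Finset (Orb (FermionTorus 2 L)))))
        ∃ᶠ β : ℝ in atTop, c * (L : ℝ) ^ 4 ≤
          ((PS * gibbsWeight β H *
              ((pairField dWaveFormFactor L)ᴴ * pairField dWaveFormFactor L)).trace /
            (PS * gibbsWeight β H).trace).re) :
    ∃ δ ∈ Set.Ioo (0:ℝ) (1/2), ∃ U₁ U₂ c : ℝ, 0 < U₁ ∧ U₁ < U₂ ∧ 0 < c ∧
      ∀ U ∈ Set.Ioo U₁ U₂, ∃ L₀ : ℕ, ∀ (L : ℕ) [NeZero L], L₀ ≤ L → Even L →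
        let N : ℕ := 2 * ⌊(1 - δ) * (L : ℝ) ^ 2 / 2⌋₊
        let H := hubbardTorus 2 L 1 U
        let S := szSector (Λ := FermionTorus 2 L) N 0
        let E₀ := S ⊓ Module.End.eigenspace (Matrix.toLin' H) ((H.minEnergyOn S : ℝ) : ℂ)
        let P := projMatrix (E₀.map (Fock.toEuclidean (ι := Orb (FermionTorus 2 L)) :
          Fock (Orb (FermionTorus 2 L)) →ₗ[ℂ] EuclideanSpace ℂ (Finset (Orb (FermionTorus 2 L)))))
        c * (L : ℝ) ^ 4 * P.trace.re ≤
          (P * ((pairField dWaveFormFactor L)ᴴ * pairField dWaveFormFactor L)).trace.re := by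
  obtain ⟨δ, hδ, U₁, U₂, c, hU₁, hU₁₂, hc, h⟩ := h
  refine ⟨δ, hδ, U₁, U₂, c, hU₁, hU₁₂, hc, fun U hU => ?_⟩
  obtain ⟨L₀, hL₀⟩ := h U hU
  refine ⟨L₀, fun L _ hL hLe => ?_⟩
  intro N H S E₀ P
  have hδ' : (-1 : ℝ) ≤ δ := by linarith [hδ.1]
  exact sectorTraceBound_of_frequently_thermal L 1 U δ c hδ' (hL₀ L hL hLe)

/-- **Eventual thermal form ⇒ the target's body (structural, Theses-free)**: as
`dWaveGroundStateAverageLRO_of_frequently_thermal` with the sector Gibbs bound for all large `β`.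
Tasaki (2020) App. A. [folklore] -/
theorem dWaveGroundStateAverageLRO_of_eventually_thermal
    (h : ∃ δ ∈ Set.Ioo (0:ℝ) (1/2), ∃ U₁ U₂ c : ℝ, 0 < U₁ ∧ U₁ < U₂ ∧ 0 < c ∧
      ∀ U ∈ Set.Ioo U₁ U₂, ∃ L₀ : ℕ, ∀ (L : ℕ) [NeZero L], L₀ ≤ L → Even L →
        let N : ℕ := 2 * ⌊(1 - δ) * (L : ℝ) ^ 2 / 2⌋₊
        let H := hubbardTorus 2 L 1 U
        let S := szSector (Λ := FermionTorus 2 L) N 0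
        let PS := projMatrix (S.map (Fock.toEuclidean (ι := Orb (FermionTorus 2 L)) :
          Fock (Orb (FermionTorus 2 L)) →ₗ[ℂ] EuclideanSpace ℂ (Finset (Orb (FermionTorus 2 L)))))
        ∀ᶠ β : ℝ in atTop, c * (L : ℝ) ^ 4 ≤
          ((PS * gibbsWeight β H *
              ((pairField dWaveFormFactor L)ᴴ * pairField dWaveFormFactor L)).trace /
            (PS * gibbsWeight β H).trace).re) :
    ∃ δ ∈ Set.Ioo (0:ℝ) (1/2), ∃ U₁ U₂ c : ℝ, 0 < U₁ ∧ U₁ < U₂ ∧ 0 < c ∧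
      ∀ U ∈ Set.Ioo U₁ U₂, ∃ L₀ : ℕ, ∀ (L : ℕ) [NeZero L], L₀ ≤ L → Even L →
        let N : ℕ := 2 * ⌊(1 - δ) * (L : ℝ) ^ 2 / 2⌋₊
        let H := hubbardTorus 2 L 1 U
        let S := szSector (Λ := FermionTorus 2 L) N 0
        let E₀ := S ⊓ Module.End.eigenspace (Matrix.toLin' H) ((H.minEnergyOn S : ℝ) : ℂ)
        let P := projMatrix (E₀.map (Fock.toEuclidean (ι := Orb (FermionTorus 2 L)) :
          Fock (Orb (FermionTorus 2 L)) →ₗ[ℂ] EuclideanSpace ℂ (Finset (Orb (FermionTorus 2 L)))))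
        c * (L : ℝ) ^ 4 * P.trace.re ≤
          (P * ((pairField dWaveFormFactor L)ᴴ * pairField dWaveFormFactor L)).trace.re := by
  obtain ⟨δ, hδ, U₁, U₂, c, hU₁, hU₁₂, hc, h⟩ := h
  refine dWaveGroundStateAverageLRO_of_frequently_thermal ⟨δ, hδ, U₁, U₂, c, hU₁, hU₁₂, hc, ?_⟩
  intro U hU
  obtain ⟨L₀, hL₀⟩ := h U hU
  refine ⟨L₀, fun L _ hL hLe => ?_⟩
  intro N H S PS
  exact (hL₀ L hL hLe).frequently

/-- Dyadic inverse temperatures `β_k = a · 2^{k+1}`, `a > 0`, are unbounded: a property holding for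
all large `k` at `β_k` holds frequently as `β → ∞`. [folklore] -/
theorem frequently_atTop_of_eventually_two_pow {p : ℝ → Prop} {a : ℝ} (ha : 0 < a)
    (h : ∀ᶠ k : ℕ in atTop, p (a * 2 ^ (k + 1))) : ∃ᶠ β : ℝ in atTop, p β := by
  have hT : Tendsto (fun k : ℕ => a * (2 : ℝ) ^ (k + 1)) atTop atTop := by
    refine Tendsto.const_mul_atTop ha ?_
    exact (tendsto_pow_atTop_atTop_of_one_lt one_lt_two).comp (tendsto_add_atTop_nat 1)
  exact hT.frequently h.frequently

/-- **Dyadic thermal form ⇒ the target's body (structural, Theses-free).** If for every `U` in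
the window, eventually in even `L`, there is a Trotter step `a > 0` such that the sector Gibbs
average of `Δ_d† Δ_d` at `β = a · 2^{k+1}` is `≥ c L⁴` for all large `k` (a functional integral
with `M = 2^{k+1}` time slices controlled uniformly in `M`), then the body of the target holds.
Tasaki (2020) App. A. [folklore] -/
theorem dWaveGroundStateAverageLRO_of_thermal_dyadic
    (h : ∃ δ ∈ Set.Ioo (0:ℝ) (1/2), ∃ U₁ U₂ c : ℝ, 0 < U₁ ∧ U₁ < U₂ ∧ 0 < c ∧
      ∀ U ∈ Set.Ioo U₁ U₂, ∃ L₀ : ℕ, ∀ (L : ℕ) [NeZero L], L₀ ≤ L → Even L →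
        let N : ℕ := 2 * ⌊(1 - δ) * (L : ℝ) ^ 2 / 2⌋₊
        let H := hubbardTorus 2 L 1 U
        let S := szSector (Λ := FermionTorus 2 L) N 0
        let PS := projMatrix (S.map (Fock.toEuclidean (ι := Orb (FermionTorus 2 L)) :
          Fock (Orb (FermionTorus 2 L)) →ₗ[ℂ] EuclideanSpace ℂ (Finset (Orb (FermionTorus 2 L)))))
        ∃ a : ℝ, 0 < a ∧ ∀ᶠ k : ℕ in atTop, c * (L : ℝ) ^ 4 ≤
          ((PS * gibbsWeight (a * 2 ^ (k + 1)) H *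
              ((pairField dWaveFormFactor L)ᴴ * pairField dWaveFormFactor L)).trace /
            (PS * gibbsWeight (a * 2 ^ (k + 1)) H).trace).re) :
    ∃ δ ∈ Set.Ioo (0:ℝ) (1/2), ∃ U₁ U₂ c : ℝ, 0 < U₁ ∧ U₁ < U₂ ∧ 0 < c ∧
      ∀ U ∈ Set.Ioo U₁ U₂, ∃ L₀ : ℕ, ∀ (L : ℕ) [NeZero L], L₀ ≤ L → Even L →
        let N : ℕ := 2 * ⌊(1 - δ) * (L : ℝ) ^ 2 / 2⌋₊
        let H := hubbardTorus 2 L 1 U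
        let S := szSector (Λ := FermionTorus 2 L) N 0
        let E₀ := S ⊓ Module.End.eigenspace (Matrix.toLin' H) ((H.minEnergyOn S : ℝ) : ℂ)
        let P := projMatrix (E₀.map (Fock.toEuclidean (ι := Orb (FermionTorus 2 L)) :
          Fock (Orb (FermionTorus 2 L)) →ₗ[ℂ] EuclideanSpace ℂ (Finset (Orb (FermionTorus 2 L)))))
        c * (L : ℝ) ^ 4 * P.trace.re ≤
          (P * ((pairField dWaveFormFactor L)ᴴ * pairField dWaveFormFactor L)).trace.re := by
  obtain ⟨δ, hδ, U₁, U₂, c, hU₁, hU₁₂, hc, h⟩ := h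
  refine dWaveGroundStateAverageLRO_of_frequently_thermal ⟨δ, hδ, U₁, U₂, c, hU₁, hU₁₂, hc, ?_⟩
  intro U hU
  obtain ⟨L₀, hL₀⟩ := h U hU
  refine ⟨L₀, fun L _ hL hLe => ?_⟩
  intro N H S PS
  obtain ⟨a, ha, hk⟩ := hL₀ L hL hLe
  exact frequently_atTop_of_eventually_two_pow (p := fun β => c * (L : ℝ) ^ 4 ≤
    ((PS * gibbsWeight β H * ((pairField dWaveFormFactor L)ᴴ * pairField dWaveFormFactor L)).trace /
      (PS * gibbsWeight β H).trace).re) ha hk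

end Summit.HubbardSuperconductivity.HubbardSuperconductivity.Theorems
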